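import Literature.NumberTheory.PAdicHodge.LubinTateDivisionTowerCoeff
import Literature.NumberTheory.PAdicHodge.EisensteinCoeffLubinTate
import HarnessLib

/-!
# `𝒪_D = ℤ_p[ϖ] → 𝒪_F` is onto for a totally ramified `F/ℚ_p`

Topic `Literature/NumberTheory/PAdicHodge`; THEOREMS plus one bookkeeping definition (`digitSeq`); sequel of
`LubinTateDivisionTowerCoeff` (`CoeffDisc.toInt D : 𝒪_D → 𝒪_F`, `ϖ_D ↦ π`) and `EisensteinCoeffLubinTate`
(`ϖ_D^e ∈ p𝒪_D`). For an Eisenstein datum `D` of `F` whose root `ϖ = π` is a uniformizer of `F`, the map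
`ι_𝒪 = CoeffDisc.toInt D : 𝒪_D = ℤ_p[X]/(f_D) → 𝒪_F` is SURJECTIVE as soon as every element of `𝒪_F` is a natural
number modulo `π` (`𝒪_F = ℤ + π𝒪_F`, i.e. `k_F = 𝔽_p`: `F/ℚ_p` totally ramified):

* `exists_pow_e_eq_natCast_mul` — `π^e = p·ι_𝒪(y)`;
* `exists_digits` — `c = Σ_{i<e} nᵢ πⁱ + p·c'` (`nᵢ ∈ ℕ`);
* `digitSeq` / `digitSeq_spec` — the `p`-adic digit expansion `b = ι_𝒪(Σᵢ zᵢ⁽ᵏ⁾ ϖⁱ) + pᵏ·c_k`, `zᵢ⁽ᵏ⁺¹⁾ ≡ zᵢ⁽ᵏ⁾ (pᵏ)`;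
* `PadicIntLimit.exists_limit` — a `p`-adically Cauchy sequence in `ℤ_p` has a limit (`ℤ_p` is `p`-adically complete);
* ★ `CoeffDisc.toInt_surjective` — `ι_𝒪` is onto (`𝒪_F` is `𝓂`-adically Hausdorff);
* `exists_nat_add_mul_of_residueFieldCard` — the hypothesis `𝒪_F = ℤ + π𝒪_F` from `#k_F = p`;
* ★ `CoeffDisc.toInt_surjective_of_residueFieldCard` — the packaged form: `#k_F = p`, `π` a uniformizer ⇒ onto.

This is Serre, *Local Fields* I §6 Prop. 18 (`𝒪_F = ℤ_p[π]` for `F/ℚ_p` totally ramified, `π` a root of an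
Eisenstein polynomial), in the form needed to let `Γ_F` act on Lubin–Tate torsion lifts through `𝒪_D`
(`LubinTateDivisionTowerCoeff.galSeq_ltDivTower`: every `χ_π(σ) ∈ 𝒪_F^×` has a preimage in `𝒪_D`).
No named facts, no `sorry`.

## References
* J.-P. Serre, *Local Fields*, GTM 67, Ch. I §6 Prop. 17–18; Ch. II §5. [SerreLocalFields1979]
* J. W. S. Cassels, A. Fröhlich (eds.), *Algebraic Number Theory*, Ch. I §6 (Eisenstein extensions). [CasselsFrohlichANT1967]
-/

noncomputable section

open Ideal Field ValuativeRel

namespace Literature.NumberTheory.PAdicHodge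

open Literature.NumberTheory.GaloisRepresentations
open Literature.NumberTheory.GaloisRepresentations.IsNonarchimedeanLocalField
open Literature.NumberTheory.GaloisRepresentations.LubinTate

/-! ## §0 `ℤ_p` is `p`-adically complete (successive-difference form) -/

namespace PadicIntLimit

variable {p : ℕ} [Fact p.Prime]

/-- Successive differences in `(pᵏ)` ⇒ `f n − f m ∈ (pᵐ)` for `m ≤ n`. [cite: SerreLocalFields1979, Ch. II §5] -/
theorem sub_mem_of_succ_sub_mem {R : Type*} [CommRing R] (q : R) (f : ℕ → R)
    (hf : ∀ k, f (k + 1) - f k ∈ Ideal.span {q ^ k}) {m n : ℕ} (hmn : m ≤ n) :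
    f n - f m ∈ Ideal.span {q ^ m} := by
  induction n, hmn using Nat.le_induction with
  | base => simp
  | succ n hmn ih =>
    have h1 : f (n + 1) - f n ∈ Ideal.span {q ^ m} :=
      Ideal.span_singleton_le_span_singleton.2 (pow_dvd_pow q hmn) (hf n)
    have : f (n + 1) - f m = (f (n + 1) - f n) + (f n - f m) := by ring
    rw [this]
    exact Ideal.add_mem _ h1 ih

/-- **A `p`-adically Cauchy sequence in `ℤ_p` converges**: if `f(k+1) ≡ f(k) (mod pᵏ)` for all `k` then there is
`L ∈ ℤ_p` with `L ≡ f(k) (mod pᵏ)` for all `k` (`ℤ_p` is `p`-adically complete). [cite: SerreLocalFields1979, Ch. II §5] -/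
theorem exists_limit (f : ℕ → ℤ_[p]) (hf : ∀ k, f (k + 1) - f k ∈ Ideal.span {(p : ℤ_[p]) ^ k}) :
    ∃ L : ℤ_[p], ∀ k, L - f k ∈ Ideal.span {(p : ℤ_[p]) ^ k} := by
  have hI : ∀ k, ((IsLocalRing.maximalIdeal ℤ_[p]) ^ k • ⊤ : Submodule ℤ_[p] ℤ_[p]) = Ideal.span {(p : ℤ_[p]) ^ k} := by
    intro k
    rw [smul_eq_mul, Ideal.mul_top, PadicInt.maximalIdeal_eq_span_p, Ideal.span_singleton_pow]
  obtain ⟨L, hL⟩ := IsPrecomplete.prec' (I := IsLocalRing.maximalIdeal ℤ_[p]) f (fun {m n} hmn => by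
    rw [SModEq.sub_mem, hI]
    have h := sub_mem_of_succ_sub_mem (p : ℤ_[p]) f hf hmn
    rwa [← Ideal.neg_mem_iff, neg_sub] at h)
  refine ⟨L, fun k => ?_⟩
  have h := hL k
  rw [SModEq.sub_mem, hI] at h
  rwa [← Ideal.neg_mem_iff, neg_sub] at h

end PadicIntLimit

variable {F : Type} [Field F] [ValuativeRel F] [TopologicalSpace F] [IsNonarchimedeanLocalField F] [CharZero F]
  {p : ℕ} [Fact p.Prime] {hp : valuation F p < 1} (D : EisensteinRoot F p hp)

namespace EisensteinRoot

/-! ## §1 Digit sums `Σᵢ zᵢ ϖ_Dⁱ ∈ 𝒪_D` -/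

/-- The digit sum `Σᵢ ι_𝒪(zᵢ) πⁱ ∈ 𝒪_D` of a coefficient vector `z ∈ ℤ_p^e`: `Σᵢ zᵢ ϖ_Dⁱ`. [folklore] -/
def CoeffDisc.ofDigits (z : Fin D.e → ℤ_[p]) : CoeffDisc D :=
  ∑ i, CoeffDisc.of D (AdjoinRoot.of D.poly (z i)) * CoeffDisc.of D (AdjoinRoot.root D.poly) ^ (i : ℕ)

/-- `ofDigits` is additive. [cite: SerreLocalFields1979, Ch. I §6 Prop. 18] -/
theorem CoeffDisc.ofDigits_add (z w : Fin D.e → ℤ_[p]) :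
    CoeffDisc.ofDigits D (z + w) = CoeffDisc.ofDigits D z + CoeffDisc.ofDigits D w := by
  simp only [CoeffDisc.ofDigits, Pi.add_apply, map_add, add_mul, Finset.sum_add_distrib]

/-- `ofDigits` is compatible with subtraction. [cite: SerreLocalFields1979, Ch. I §6 Prop. 18] -/
theorem CoeffDisc.ofDigits_sub (z w : Fin D.e → ℤ_[p]) :
    CoeffDisc.ofDigits D (z - w) = CoeffDisc.ofDigits D z - CoeffDisc.ofDigits D w := by
  simp only [CoeffDisc.ofDigits, Pi.sub_apply, map_sub, sub_mul, Finset.sum_sub_distrib]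

/-- `ι_𝒪(ofDigits z) ∈ (pᵏ)` when every `zᵢ ∈ (pᵏ)`. [cite: SerreLocalFields1979, Ch. I §6 Prop. 18] -/
theorem CoeffDisc.toInt_ofDigits_mem (k : ℕ) {z : Fin D.e → ℤ_[p]} (hz : ∀ i, z i ∈ Ideal.span {(p : ℤ_[p]) ^ k}) :
    CoeffDisc.toInt D (CoeffDisc.ofDigits D z) ∈ Ideal.span {(p : 𝒪[F]) ^ k} := by
  unfold CoeffDisc.ofDigits
  rw [map_sum]
  refine Ideal.sum_mem _ fun i _ => ?_
  obtain ⟨w, hw⟩ := Ideal.mem_span_singleton'.1 (hz i)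
  rw [← hw]
  simp only [map_mul, map_pow, map_natCast]
  exact Ideal.mul_mem_right _ _ (Ideal.mul_mem_left _ _ (Ideal.mem_span_singleton_self _))

variable {π : 𝒪[F]} (hπD : (π : F) = D.root)

include hπD

/-! ## §2 Digits: `π^e = p·ι(y)`, `c = Σ nᵢ πⁱ + p c'` -/

/-- **`π^e = p·ι_𝒪(y)`** for some `y ∈ 𝒪_D` (`ϖ_D^e ∈ p𝒪_D`, Eisenstein). [cite: SerreLocalFields1979, Ch. I §6 Prop. 17] -/
theorem exists_pow_e_eq_natCast_mul : ∃ y : CoeffDisc D, π ^ D.e = (p : 𝒪[F]) * CoeffDisc.toInt D y := by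
  obtain ⟨y, hy⟩ := Ideal.mem_span_singleton'.1 D.root_pow_e_mem_span_natCast
  refine ⟨CoeffDisc.of D y, ?_⟩
  rw [← CoeffDisc.toInt_root D hπD, ← map_pow, ← map_natCast (CoeffDisc.toInt D), ← map_mul,
    ← map_natCast (CoeffDisc.of D), ← map_pow, ← map_mul, mul_comm, hy]

/-- `ι_𝒪` on a natural-number digit vector scaled by `pᵏ`: `pᵏ·Σ nᵢ πⁱ`. [cite: SerreLocalFields1979, Ch. I §6 Prop. 18] -/
theorem CoeffDisc.toInt_ofDigits_natCast (k : ℕ) (n : Fin D.e → ℕ) :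
    CoeffDisc.toInt D (CoeffDisc.ofDigits D fun i => (p : ℤ_[p]) ^ k * n i) =
      (p : 𝒪[F]) ^ k * ∑ i, (n i : 𝒪[F]) * π ^ (i : ℕ) := by
  unfold CoeffDisc.ofDigits
  rw [map_sum, Finset.mul_sum]
  refine Finset.sum_congr rfl fun i _ => ?_
  simp only [map_mul, map_pow, map_natCast, CoeffDisc.toInt_root D hπD]
  ring

/-- **Digits modulo `p`**: if `𝒪_F = ℤ + π𝒪_F` then every `c ∈ 𝒪_F` is `Σ_{i<e} nᵢ πⁱ + p·c'` with `nᵢ ∈ ℕ`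
(`e` steps of `c = n + π c'`, then `π^e = p·ι(y)`). [cite: SerreLocalFields1979, Ch. I §6 Prop. 18] -/
theorem exists_digits (hres : ∀ b : 𝒪[F], ∃ n : ℕ, ∃ b' : 𝒪[F], b = n + π * b') (c : 𝒪[F]) :
    ∃ n : Fin D.e → ℕ, ∃ c' : 𝒪[F], c = (∑ i, (n i : 𝒪[F]) * π ^ (i : ℕ)) + (p : 𝒪[F]) * c' := by
  have key : ∀ j : ℕ, ∃ n : ℕ → ℕ, ∃ c' : 𝒪[F], c = (∑ i ∈ Finset.range j, (n i : 𝒪[F]) * π ^ i) + π ^ j * c' := by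
    intro j
    induction j with
    | zero => exact ⟨fun _ => 0, c, by simp⟩
    | succ j ih =>
      obtain ⟨n, c', hc⟩ := ih
      obtain ⟨m, c'', hc'⟩ := hres c'
      refine ⟨Function.update n j m, c'', ?_⟩
      rw [Finset.sum_range_succ, Function.update_self,
        Finset.sum_congr rfl fun i hi => by rw [Function.update_of_ne (Finset.mem_range.1 hi).ne], hc, hc']
      ring
  obtain ⟨n, c', hc⟩ := key D.e
  obtain ⟨y, hy⟩ := exists_pow_e_eq_natCast_mul D hπD
  refine ⟨fun i => n i, CoeffDisc.toInt D y * c', ?_⟩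
  rw [Finset.sum_range (fun i => (n i : 𝒪[F]) * π ^ i)] at hc
  rw [hc, hy, mul_assoc]

/-! ## §3 The `p`-adic digit expansion and its limit -/

section Seq

variable (hres : ∀ b : 𝒪[F], ∃ n : ℕ, ∃ b' : 𝒪[F], b = n + π * b')

/-- The digit recursion: `(z⁽ᵏ⁾, c_k)` with `b = ι(ofDigits z⁽ᵏ⁾) + pᵏ c_k`, `z⁽⁰⁾ = 0`, `c₀ = b`,
`z⁽ᵏ⁺¹⁾ = z⁽ᵏ⁾ + pᵏ·(digits of c_k)`. [folklore] -/
def digitSeq (b : 𝒪[F]) : ℕ → (Fin D.e → ℤ_[p]) × 𝒪[F]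
  | 0 => (0, b)
  | k + 1 =>
    ((digitSeq b k).1 + fun i => (p : ℤ_[p]) ^ k * (Classical.choose (exists_digits D hπD hres (digitSeq b k).2) i : ℕ),
      Classical.choose (Classical.choose_spec (exists_digits D hπD hres (digitSeq b k).2)))

/-- The invariant of the digit recursion: `b = ι_𝒪(ofDigits z⁽ᵏ⁾) + pᵏ·c_k`. [cite: SerreLocalFields1979, Ch. I §6 Prop. 18] -/
theorem digitSeq_spec (b : 𝒪[F]) (k : ℕ) :
    b = CoeffDisc.toInt D (CoeffDisc.ofDigits D (digitSeq D hπD hres b k).1) + (p : 𝒪[F]) ^ k * (digitSeq D hπD hres b k).2 := by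
  induction k with
  | zero => simp [digitSeq, CoeffDisc.ofDigits]
  | succ k ih =>
    have hs := Classical.choose_spec (Classical.choose_spec (exists_digits D hπD hres (digitSeq D hπD hres b k).2))
    change b = CoeffDisc.toInt D (CoeffDisc.ofDigits D ((digitSeq D hπD hres b k).1 + fun i =>
        (p : ℤ_[p]) ^ k * (Classical.choose (exists_digits D hπD hres (digitSeq D hπD hres b k).2) i : ℕ))) +
      (p : 𝒪[F]) ^ (k + 1) * Classical.choose (Classical.choose_spec (exists_digits D hπD hres (digitSeq D hπD hres b k).2))
    rw [CoeffDisc.ofDigits_add, map_add, CoeffDisc.toInt_ofDigits_natCast D hπD, add_assoc, pow_succ, mul_assoc, ← mul_add,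
      ← hs]
    exact ih

/-- The digit vectors are `p`-adically Cauchy: `z⁽ᵏ⁺¹⁾ᵢ − z⁽ᵏ⁾ᵢ ∈ (pᵏ)`. [cite: SerreLocalFields1979, Ch. I §6 Prop. 18] -/
theorem digitSeq_succ_sub (b : 𝒪[F]) (k : ℕ) (i : Fin D.e) :
    (digitSeq D hπD hres b (k + 1)).1 i - (digitSeq D hπD hres b k).1 i ∈ Ideal.span {(p : ℤ_[p]) ^ k} := by
  change ((digitSeq D hπD hres b k).1 + fun i =>
      (p : ℤ_[p]) ^ k * (Classical.choose (exists_digits D hπD hres (digitSeq D hπD hres b k).2) i : ℕ)) i -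
    (digitSeq D hπD hres b k).1 i ∈ _
  rw [Pi.add_apply, add_sub_cancel_left]
  exact Ideal.mul_mem_right _ _ (Ideal.mem_span_singleton_self _)

/-- ★ **`𝒪_D → 𝒪_F` is onto** when `𝒪_F = ℤ + π𝒪_F` (`π = ϖ_D` the Eisenstein root): `b = ι_𝒪(Σᵢ zᵢ ϖ_Dⁱ)` with
`zᵢ = lim z⁽ᵏ⁾ᵢ ∈ ℤ_p`, since `b − ι_𝒪(Σᵢ zᵢ ϖ_Dⁱ) ∈ ⋂ₖ pᵏ𝒪_F = 0`. [cite: SerreLocalFields1979, Ch. I §6 Prop. 18] -/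
theorem CoeffDisc.toInt_surjective (hres : ∀ b : 𝒪[F], ∃ n : ℕ, ∃ b' : 𝒪[F], b = n + π * b') : Function.Surjective (CoeffDisc.toInt D) := by
  intro b
  have hlim : ∀ i, ∃ L : ℤ_[p], ∀ k, L - (digitSeq D hπD hres b k).1 i ∈ Ideal.span {(p : ℤ_[p]) ^ k} := fun i =>
    PadicIntLimit.exists_limit _ fun k => digitSeq_succ_sub D hπD hres b k i
  choose L hL using hlim
  refine ⟨CoeffDisc.ofDigits D L, ?_⟩
  -- `b − ι(ofDigits L) ∈ pᵏ𝒪_F ⊆ 𝓂^k` for every `k`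
  have hp𝓂 : (p : 𝒪[F]) ∈ 𝓂[F] := (mem_maximalIdeal_iff_valuation_lt_one _).2 hp
  refine (sub_eq_zero.1 (IsHausdorff.haus' (I := 𝓂[F]) (b - CoeffDisc.toInt D (CoeffDisc.ofDigits D L)) fun k => ?_)).symm
  rw [SModEq.sub_mem, sub_zero, smul_eq_mul, Ideal.mul_top]
  have hk : b - CoeffDisc.toInt D (CoeffDisc.ofDigits D L) =
      (p : 𝒪[F]) ^ k * (digitSeq D hπD hres b k).2 - CoeffDisc.toInt D (CoeffDisc.ofDigits D (L - (digitSeq D hπD hres b k).1)) := by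
    rw [CoeffDisc.ofDigits_sub, map_sub]
    conv_lhs => rw [digitSeq_spec D hπD hres b k]
    ring
  rw [hk]
  have hsub : Ideal.span {(p : 𝒪[F]) ^ k} ≤ 𝓂[F] ^ k := by
    rw [Ideal.span_singleton_le_iff_mem]
    exact Ideal.pow_mem_pow hp𝓂 k
  exact hsub (Ideal.sub_mem _ (Ideal.mul_mem_right _ _ (Ideal.mem_span_singleton_self _))
    (CoeffDisc.toInt_ofDigits_mem D k fun i => hL i k))

end Seq

/-! ## §4 `#k_F = p` ⇒ `𝒪_F = ℤ + π𝒪_F` ⇒ onto -/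

omit [CharZero F] hπD in
/-- **`𝒪_F = ℤ + π𝒪_F` when `#k_F = p`** and `π` is a uniformizer: `k_F = 𝔽_p` is generated by `1`.
[cite: SerreLocalFields1979, Ch. I §6 Prop. 18] -/
theorem exists_nat_add_mul_of_residueFieldCard (hk : residueFieldCard F = p) (hπ : (valuation F).IsUniformizer (π : F))
    (b : 𝒪[F]) : ∃ n : ℕ, ∃ b' : 𝒪[F], b = n + π * b' := by
  classical
  letI : Fintype 𝓀[F] := Fintype.ofFinite _
  have hcard : Fintype.card 𝓀[F] = p := by
    rw [← Nat.card_eq_fintype_card]; exact hk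
  let e : ZMod p ≃+* 𝓀[F] := ZMod.ringEquivOfPrime 𝓀[F] (Fact.out : p.Prime) hcard
  set m : ZMod p := e.symm (IsLocalRing.residue 𝒪[F] b) with hm
  have hres : IsLocalRing.residue 𝒪[F] b = (m.val : 𝓀[F]) := by
    rw [← map_natCast e, ZMod.natCast_zmod_val, hm, RingEquiv.apply_symm_apply]
  have hmem : b - (m.val : 𝒪[F]) ∈ 𝓂[F] := by
    rw [← IsLocalRing.residue_eq_zero_iff, map_sub, map_natCast, hres, sub_self]
  obtain ⟨b', hb'⟩ := dvd_of_mem_maximalIdeal F hπ hmem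
  exact ⟨m.val, b', by rw [← hb', add_sub_cancel]⟩

/-- ★ **Totally ramified case, packaged**: if `#k_F = p` and the Eisenstein root `π = ϖ_D` is a uniformizer of `F`,
then `ι_𝒪 : 𝒪_D → 𝒪_F` is onto (`𝒪_F = ℤ_p[π]`). [cite: SerreLocalFields1979, Ch. I §6 Prop. 18] -/
theorem CoeffDisc.toInt_surjective_of_residueFieldCard (hk : residueFieldCard F = p)
    (hπ : (valuation F).IsUniformizer (π : F)) : Function.Surjective (CoeffDisc.toInt D) :=
  CoeffDisc.toInt_surjective D hπD (exists_nat_add_mul_of_residueFieldCard hk hπ)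

/-- Consequence used by the Lubin–Tate period files: every value `χ_π(σ)` of the Lubin–Tate character has a preimage
in `𝒪_D`. [cite: SerreLocalFields1979, Ch. I §6 Prop. 18] -/
theorem CoeffDisc.exists_toInt_eq_lubinTateChar (hk : residueFieldCard F = p) (hπ : (valuation F).IsUniformizer (π : F))
    (σ : absoluteGaloisGroup F) : ∃ a : CoeffDisc D, CoeffDisc.toInt D a = (lubinTateChar hπ σ : 𝒪[F]) :=
  CoeffDisc.toInt_surjective_of_residueFieldCard D hπD hk hπ _

end EisensteinRoot

end Literature.NumberTheory.PAdicHodge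

end
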